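import Literature.MathematicalPhysics.QuantumManyBody.DiluteBoseGasLHYUpperBound
import Literature.MathematicalPhysics.QuantumManyBody.DiluteBoseGasUpperBound
import HarnessLib

/-!
# Basti–Cenatiempo–Schlein 2021, Theorem 1.1: the two vendored renderings are equivalent

Topic `Literature/MathematicalPhysics/QuantumManyBody`, proofs companion of
`DiluteBoseGasLHYUpperBound.lean` (provefact
`Literature.MathematicalPhysics.QuantumManyBody.BoseGas.BCS2021_lhyUpperBound_dirichlet`).

The tree carries TWO named facts for one printed theorem, [BastiCenatiempoSchlein2021, Thm. 1.1]
("Let `V ∈ L³(ℝ³)` be non-negative, radially symmetric, with `supp(V) ⊂ B_R(0)` and scattering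
length `𝔞 ≤ R`. Then … `e(ρ) ≤ 4πρ²𝔞[1 + (128/(15√π))(ρ𝔞³)^{1/2}] + Cρ^{5/2+1/10}` for some `C > 0`
and for `ρ` small enough", arXiv:2101.06222 p. 3), both over the same carriers
(`groundStateEnergy`, `sideLength`, `scatteringLength`) and both with the thermodynamic limit
entered as the `limsup` of `E(N, L_N)/L_N³`, `L_N = (N/ρ)^{1/3}`:

* `BCS2021_lhyUpperBound_dirichlet` (`DiluteBoseGasLHYUpperBound.lean`): support hypothesis
  `v(r) = 0` for `r ≥ R`, finiteness `scatteringLength v ≠ ⊤`, constant `128/(15√π)` written out,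
  conclusion `∃ C ρ₀, 0 < ρ₀ ∧ …`;
* `BastiCenatiempoSchlein2021_upperBound` (`DiluteBoseGasUpperBound.lean`): support hypothesis
  `v(r) = 0` for `r > R`, the printed `𝔞 ≤ R` as `scatteringLength v ≤ ENNReal.ofReal R`, the
  constant as `lhyConstant`, conclusion `∃ C ρ₁, 0 < C ∧ 0 < ρ₁ ∧ …`.

This file PROVES that the two renderings are logically equivalent
(`BCS2021_lhyUpperBound_dirichlet_iff_upperBound`), so that they are one literature debt, not two:
whichever is discharged first discharges the other through
`BCS2021_lhyUpperBound_dirichlet_of_upperBound` /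
`BastiCenatiempoSchlein2021_upperBound_of_lhyUpperBound_dirichlet`.  The two directions are the
bookkeeping the source itself performs in its hypotheses: "`supp V ⊂ B_R(0)`, `𝔞 ≤ R`" only fix a
radius beyond which `V` vanishes and which dominates `𝔞` — given any support radius `R` and a finite
`𝔞`, the radius `max R 𝔞` (resp. `R + 1`) serves, and the conclusion does not mention `R`; the
printed "`C > 0`" is recovered from an arbitrary real `C` as `max C 1` since `ρ^{5/2+1/10} ≥ 0`.
Theorem 1.1 itself is NOT proved here (its printed proof is Prop. 1.3, a Bogoliubov trial state on
the Fock space of a periodic box of side `ρ̃^{-γ}`, §§2–5, followed by the localisation Prop. 1.2,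
App. A, Lemmas A.1–A.4).

## References

* [BastiCenatiempoSchlein2021] G. Basti, S. Cenatiempo, B. Schlein, *A new second-order upper bound
  for the ground state energy of dilute Bose gases*, Forum Math. Sigma 9 (2021) e74
  (arXiv:2101.06222), Thm. 1.1 (p. 3), Props. 1.2–1.3, App. A.
-/

noncomputable section

open MeasureTheory Filter Metric
open scoped ENNReal NNReal Topology

namespace Literature.MathematicalPhysics.QuantumManyBody.BoseGas

/-- **Theorem 1.1, rendering `BastiCenatiempoSchlein2021_upperBound` ⇒ rendering
`BCS2021_lhyUpperBound_dirichlet`.** Given a profile vanishing on `[R, ∞)` with finite scattering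
length `𝔞`, apply the other rendering with the radius `max R 𝔞` (then `v = 0` beyond it and
`𝔞 ≤ max R 𝔞`, the printed normalisation "`supp V ⊂ B_R(0)`, `𝔞 ≤ R`"); the conclusions agree
(`lhyConstant = 128/(15√π)`). [cite: BastiCenatiempoSchlein2021, Thm. 1.1] -/
theorem BCS2021_lhyUpperBound_dirichlet_of_upperBound
    (h : BastiCenatiempoSchlein2021_upperBound) : BCS2021_lhyUpperBound_dirichlet := by
  intro v R hmeas hR hL3 hatop
  have hR' : ∀ r, max R (scatteringLength v).toReal < r → v r = 0 := fun r hr =>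
    hR r ((le_max_left _ _).trans hr.le)
  have haR : scatteringLength v ≤ ENNReal.ofReal (max R (scatteringLength v).toReal) :=
    calc scatteringLength v = ENNReal.ofReal (scatteringLength v).toReal :=
        (ENNReal.ofReal_toReal hatop).symm
      _ ≤ ENNReal.ofReal (max R (scatteringLength v).toReal) :=
        ENNReal.ofReal_le_ofReal (le_max_right _ _)
  obtain ⟨C, ρ₁, -, hρ₁, hC⟩ := h v _ hmeas hR' hL3 haR
  refine ⟨C, ρ₁, hρ₁, fun ρ hρ hρ1 => ?_⟩
  have h1 := hC ρ hρ hρ1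
  simp only [lhyConstant] at h1
  simpa using h1

/-- **Theorem 1.1, rendering `BCS2021_lhyUpperBound_dirichlet` ⇒ rendering
`BastiCenatiempoSchlein2021_upperBound`.** Given a profile vanishing on `(R, ∞)` with `𝔞 ≤ R`
(so `𝔞 < ∞`), apply the other rendering with the radius `R + 1`; a constant `C` is replaced by
`max C 1 > 0`, which only enlarges the bound since `ρ^{5/2+1/10} ≥ 0`.
[cite: BastiCenatiempoSchlein2021, Thm. 1.1] -/
theorem BastiCenatiempoSchlein2021_upperBound_of_lhyUpperBound_dirichlet
    (h : BCS2021_lhyUpperBound_dirichlet) : BastiCenatiempoSchlein2021_upperBound := by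
  intro v R hmeas hR hL3 haR
  have hatop : scatteringLength v ≠ ⊤ := ne_top_of_le_ne_top ENNReal.ofReal_ne_top haR
  have hR1 : ∀ r, R + 1 ≤ r → v r = 0 := fun r hr => hR r (by linarith)
  obtain ⟨C, ρ₀, hρ₀, hC⟩ := h v (R + 1) hmeas hR1 hL3 hatop
  refine ⟨max C 1, ρ₀, lt_max_of_lt_right one_pos, hρ₀, fun ρ hρ hρ0 => ?_⟩
  have h1 := hC ρ hρ hρ0
  simp only at h1
  simp only [lhyConstant]
  refine h1.trans (ENNReal.ofReal_le_ofReal ?_)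
  have hpow : 0 ≤ ρ ^ ((5 : ℝ) / 2 + 1 / 10) := Real.rpow_nonneg hρ.le _
  have hCle : C * ρ ^ ((5 : ℝ) / 2 + 1 / 10) ≤ max C 1 * ρ ^ ((5 : ℝ) / 2 + 1 / 10) :=
    mul_le_mul_of_nonneg_right (le_max_left _ _) hpow
  simpa using hCle

/-- **The two vendored renderings of [BastiCenatiempoSchlein2021, Thm. 1.1] are equivalent**:
`BCS2021_lhyUpperBound_dirichlet ↔ BastiCenatiempoSchlein2021_upperBound` — one literature debt.
[cite: BastiCenatiempoSchlein2021, Thm. 1.1] -/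
theorem BCS2021_lhyUpperBound_dirichlet_iff_upperBound :
    BCS2021_lhyUpperBound_dirichlet ↔ BastiCenatiempoSchlein2021_upperBound :=
  ⟨BastiCenatiempoSchlein2021_upperBound_of_lhyUpperBound_dirichlet,
    BCS2021_lhyUpperBound_dirichlet_of_upperBound⟩

/-- The route's fixed-density corollary of `DiluteBoseGasLHYUpperBound.lean` therefore also follows
from the other rendering. [cite: BastiCenatiempoSchlein2021, Thm. 1.1] -/
theorem lhyOrder_upperBound_dirichlet_of_BastiCenatiempoSchlein2021
    (h : BastiCenatiempoSchlein2021_upperBound) :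
    ∀ v : ℝ → ℝ≥0∞, IsRepulsiveFiniteRange v → (∫⁻ x : Space, v ‖x‖) ≠ ⊤ →
      (∃ C : ℝ, ∀ r, v r ≤ ENNReal.ofReal C) → 0 < scatteringLength v →
      ∃ C ρ₁ : ℝ, 0 < ρ₁ ∧ ∀ ρ : ℝ, 0 < ρ → ρ < ρ₁ → ∀ᶠ N : ℕ in Filter.atTop,
        groundStateEnergy v N (sideLength ρ N) ≤
          ENNReal.ofReal (4 * Real.pi * ρ * (scatteringLength v).toReal *
            (1 + C * Real.sqrt (ρ * (scatteringLength v).toReal ^ 3)) * N) :=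
  lhyOrder_upperBound_dirichlet_of_BCS2021 (BCS2021_lhyUpperBound_dirichlet_of_upperBound h)

end Literature.MathematicalPhysics.QuantumManyBody.BoseGas

end
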